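import Summits.RiemannHypothesis.RiemannHypothesis.Theorems.WeilTwoPrimeDeflE25EBase
import Summits.RiemannHypothesis.RiemannHypothesis.Theorems.WeilTwoPrimeDeflE25EDataDnE18
import Literature.NumberTheory.LFunctions.WeilBlockRowsPZ
import HarnessLib

/-!
# Even-sector deflated two-prime certificate E25E: the factored even inverse agrees with `D`, rows 16–19

`WeilCert.checkDnRow` (even block) for certificate E25E, by `decide +kernel`. Pure proof file.
-/

set_option linter.dupNamespace false

noncomputable section

namespace Summit.RiemannHypothesis.RiemannHypothesis.Theorems.EvenWinsBeyondArch

open Literature.NumberTheory.LFunctions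

set_option maxHeartbeats 0 in
/-- Row 16 of `DnE/LsE` is row 16 of the even `D` (certificate E25E). [folklore] -/
theorem checkDnRow0_16_weilCertDeflE25E : weilCertDeflE25EBase.checkDnRow weilCertDeflE25EDnE weilCertDeflE25ELsE 0 16 = true := by
  decide +kernel

set_option maxHeartbeats 0 in
/-- Row 17 of `DnE/LsE` is row 17 of the even `D` (certificate E25E). [folklore] -/
theorem checkDnRow0_17_weilCertDeflE25E : weilCertDeflE25EBase.checkDnRow weilCertDeflE25EDnE weilCertDeflE25ELsE 0 17 = true := by
  decide +kernel

set_option maxHeartbeats 0 in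
/-- Row 18 of `DnE/LsE` is row 18 of the even `D` (certificate E25E). [folklore] -/
theorem checkDnRow0_18_weilCertDeflE25E : weilCertDeflE25EBase.checkDnRow weilCertDeflE25EDnE weilCertDeflE25ELsE 0 18 = true := by
  decide +kernel

set_option maxHeartbeats 0 in
/-- Row 19 of `DnE/LsE` is row 19 of the even `D` (certificate E25E). [folklore] -/
theorem checkDnRow0_19_weilCertDeflE25E : weilCertDeflE25EBase.checkDnRow weilCertDeflE25EDnE weilCertDeflE25ELsE 0 19 = true := by
  decide +kernel


end Summit.RiemannHypothesis.RiemannHypothesis.Theorems.EvenWinsBeyondArch
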